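import Mathlib.Algebra.Order.Field.Basic
import Mathlib.Algebra.Order.Field.Rat
import Mathlib.Algebra.Order.Ring.Basic
import Mathlib.Data.Rat.Cast.Order
import Mathlib.Data.Rat.Cast.CharZero
import Mathlib.Data.Real.Basic
import Mathlib.Data.List.GetD
import Mathlib.Tactic.Ring
import Mathlib.Tactic.Linarith
import Mathlib.Tactic.LinearCombination
import Mathlib.Tactic.Positivity
import Mathlib.Tactic.NormNum
import HarnessLib

/-!
# Rational SOS / Positivstellensatz certificates, checkable by `decide +kernel`

Compute-infrastructure file (unit `infra-psd-sos-lp-checker`). A *weighted rational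
sum-of-squares certificate* for a polynomial inequality
`p(x) ≥ 0 whenever g₁(x) ≥ 0, …, g_a(x) ≥ 0 and h₁(x) = 0, …, h_b(x) = 0`
(all polynomials with RATIONAL coefficients, `x` ranging over any linearly ordered field, e.g.
`ℝ`) consists of nonnegative rational weights and rational polynomials such that the identity
`p = Σ_k w_k q_k² + Σ_i g_i · (Σ_k w_{ik} q_{ik}²) + Σ_j h_j · t_j`
holds coefficientwise (Blekherman–Parrilo–Thomas 2012, (3.30) and Thm 3.127; weighted squares
with rational weights are exactly what a rational Gram matrix `Q = Lᵀ D L` delivers, Thm 3.43 and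
Peyrl–Parrilo 2008). Checking such a certificate is pure rational polynomial arithmetic, done
here by a small computable sparse-polynomial kernel (`Monomial = List ℕ` exponent vectors,
`Poly = List (Monomial × ℚ)`), so for numeral data `SOS.check p gs hs cert = true` is closed by
`by decide +kernel` (or `native_decide` for very large certificates, `--computational` regime),
and `SOS.nonneg_of_check` turns it into `0 ≤ p.eval x` under the hypotheses. The semantics
`Poly.eval` unfolds by `simp` to an honest polynomial expression in `x 0, x 1, …`, which `ring` /
`linarith` match against the user's goal (see the tests at the end).

## API (namespace `Literature.Computation.Certificates.SOS`)

* `Monomial`, `Monomial.eval`, `Monomial.mul`, `Monomial.trim`; `Poly`, `Poly.eval`, `Poly.C`,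
  `Poly.X`, `Poly.neg`, `Poly.smul`, `Poly.mulTerm`, `Poly.add` (sorted merge), `Poly.mul`,
  `Poly.norm`, `Poly.isZero`, with the evaluation lemmas `eval_add`, `eval_mul`, `eval_norm`,
  `eval_eq_zero_of_isZero`, … (soundness never depends on term order; order only makes the
  merge complete).
* `sumSq`, `eval_sumSq_nonneg`; `ineqPart`, `eqPart`; the certificate record `Cert`, the checker
  `check` and the soundness theorem `nonneg_of_check`; `vars` (a point `ℕ → R` from a list).
* Preorder (Schmüdgen / Handelman-type) certificates with multipliers on PRODUCTS of hypotheses: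
  `hypProd`, `preorderPart`, `CertP`, `checkP`, `nonneg_of_checkP` (appended 2026-08-16).
* Kernel-checked `example`s at the end: tests and usage templates, including the passage from
  `0 ≤ p.eval x` to a concrete real inequality.

## References

G. Blekherman, P. Parrilo, R. Thomas (eds.), *Semidefinite Optimization and Convex Algebraic
Geometry*, SIAM 2012, §3.1.4 (Gram matrices, Thm 3.39), §3.1.6 (rational SOS, Thm 3.43),
§3.4.3 (Positivstellensatz certificates, Thm 3.127, representation (3.30))
[cite: BlekhermanParriloThomas2012, Thm 3.43]; H. Peyrl, P. A. Parrilo, *Computing sum of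
squares decompositions with rational coefficients*, Theoret. Comput. Sci. 409 (2008) 269–281
[cite: PeyrlParrilo2008, §3]. Statement shape as in `Literature.Analysis.ValidatedNumerics.Verifier`.

## Not here

No SDP solver, no rounding/projection step (certificates are produced off-line and only
checked), no completeness claims, no `MvPolynomial` bridge (Mathlib's polynomials are not
computable; the bridge to a concrete goal is `simp` + `ring` on `Poly.eval`).
-/

namespace Literature.Computation.Certificates

namespace SOS

/-! ### Monomials -/

/-- Monomials in the variables `x 0, x 1, …` as dense exponent vectors: `[e₀, e₁, …]` denotes
`∏ᵢ (x i) ^ eᵢ` (missing entries are `0`). [folklore] -/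
abbrev Monomial := List ℕ

namespace Monomial

section Semiring

variable {R : Type*} [CommSemiring R]

/-- Value of the exponent vector `m` read from variable index `k` on:
`evalFrom x k [e₀, e₁, …] = (x k) ^ e₀ * (x (k+1)) ^ e₁ * ⋯`. [folklore] -/
def evalFrom (x : ℕ → R) : ℕ → Monomial → R
  | _, [] => 1
  | k, e :: es => x k ^ e * evalFrom x (k + 1) es

/-- Value of a monomial at the point `x : ℕ → R`. [folklore] -/
def eval (x : ℕ → R) (m : Monomial) : R :=
  evalFrom x 0 m

/-- `evalFrom` of the empty exponent vector. [folklore] -/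
@[simp] theorem evalFrom_nil (x : ℕ → R) (k : ℕ) : evalFrom x k [] = 1 := rfl

/-- `evalFrom` of a nonempty exponent vector. [folklore] -/
@[simp] theorem evalFrom_cons (x : ℕ → R) (k e : ℕ) (es : Monomial) :
    evalFrom x k (e :: es) = x k ^ e * evalFrom x (k + 1) es := rfl

/-- `eval` is `evalFrom` at index `0`. [folklore] -/
@[simp] theorem eval_eq (x : ℕ → R) (m : Monomial) : eval x m = evalFrom x 0 m := rfl

/-- Product of monomials: pointwise sum of exponent vectors (with zero padding). [folklore] -/
def mul : Monomial → Monomial → Monomial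
  | [], m => m
  | e :: es, [] => e :: es
  | e :: es, e' :: es' => (e + e') :: mul es es'

/-- `Monomial.mul` is multiplicative for `evalFrom`. [folklore] -/
theorem evalFrom_mul (x : ℕ → R) :
    ∀ (k : ℕ) (a b : Monomial), evalFrom x k (mul a b) = evalFrom x k a * evalFrom x k b
  | k, [], b => by simp [mul]
  | k, e :: es, [] => by simp [mul]
  | k, e :: es, e' :: es' => by
      rw [mul, evalFrom_cons, evalFrom_cons, evalFrom_cons, evalFrom_mul x (k + 1) es es', pow_add]
      ring

/-- `Monomial.mul` is multiplicative for `eval`. [folklore] -/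
theorem eval_mul (x : ℕ → R) (a b : Monomial) : eval x (mul a b) = eval x a * eval x b :=
  evalFrom_mul x 0 a b

/-- Drop trailing zero exponents (canonical form of an exponent vector). [folklore] -/
def trim : Monomial → Monomial
  | [] => []
  | e :: es =>
    match trim es with
    | [] => if e = 0 then [] else [e]
    | e' :: es' => e :: e' :: es'

/-- Trimming does not change the value. [folklore] -/
theorem evalFrom_trim (x : ℕ → R) : ∀ (k : ℕ) (m : Monomial), evalFrom x k (trim m) = evalFrom x k m
  | k, [] => rfl
  | k, e :: es => by
      have ih := evalFrom_trim x (k + 1) es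
      rw [trim]
      rcases h : trim es with _ | ⟨e', es'⟩
      · rw [h] at ih
        simp only
        split_ifs with he
        · subst he; simp [← ih]
        · simp [← ih]
      · rw [h] at ih
        simp only [evalFrom_cons]
        rw [← ih, evalFrom_cons]

/-- Strict lexicographic comparison of exponent vectors (a shorter prefix is smaller). On
trimmed vectors this is a monomial order; the checker's soundness does not depend on it, only the
completeness of the merge does. [folklore] -/
def blt : Monomial → Monomial → Bool
  | [], [] => false
  | [], _ :: _ => true
  | _ :: _, [] => false
  | e :: es, e' :: es' => Nat.blt e e' || (Nat.beq e e' && blt es es')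

end Semiring

end Monomial

/-! ### Sparse rational polynomials -/

/-- Sparse polynomials with rational coefficients: lists of (monomial, coefficient) terms. No
invariant is imposed (repeated monomials and zero coefficients are allowed; the value is the sum
of the terms). [folklore] -/
abbrev Poly := List (Monomial × ℚ)

namespace Poly

section Field

variable {R : Type*} [Field R]

/-- Value of a sparse polynomial at `x : ℕ → R` (coefficients cast into `R`). [folklore] -/
def eval (x : ℕ → R) : Poly → R
  | [] => 0
  | (m, c) :: p => (c : R) * m.eval x + eval x p

/-- `eval` of the empty term list. [folklore] -/
@[simp] theorem eval_nil (x : ℕ → R) : eval x ([] : Poly) = 0 := rfl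

/-- `eval` of a cons. [folklore] -/
@[simp] theorem eval_cons (x : ℕ → R) (m : Monomial) (c : ℚ) (p : Poly) :
    eval x ((m, c) :: p) = (c : R) * m.eval x + eval x p := rfl

/-- `eval` is additive over concatenation. [folklore] -/
theorem eval_append (x : ℕ → R) : ∀ p q : Poly, eval x (p ++ q) = eval x p + eval x q
  | [], q => by simp
  | (m, c) :: p, q => by rw [List.cons_append, eval_cons, eval_cons, eval_append x p q, add_assoc]

/-- The constant polynomial `c`. [folklore] -/
def C (c : ℚ) : Poly := [([], c)]

/-- `eval` of a constant. [folklore] -/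
@[simp] theorem eval_C (x : ℕ → R) (c : ℚ) : eval x (C c) = c := by simp [C]

/-- The variable `x i` as a polynomial. [folklore] -/
def X (i : ℕ) : Poly := [(List.replicate i 0 ++ [1], 1)]

/-- The exponent vector `0,…,0,1` (with `i` zeros) read from index `k` evaluates to `x (k + i)`.
[folklore] -/
theorem evalFrom_replicate_append_one {S : Type*} [CommSemiring S] (x : ℕ → S) :
    ∀ i k : ℕ, Monomial.evalFrom x k (List.replicate i 0 ++ [1]) = x (k + i)
  | 0, k => by simp
  | i + 1, k => by
      rw [List.replicate_succ, List.cons_append, Monomial.evalFrom_cons, pow_zero, one_mul,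
        evalFrom_replicate_append_one x i (k + 1)]
      congr 1; ring

/-- `eval` of a variable. [folklore] -/
@[simp] theorem eval_X (x : ℕ → R) (i : ℕ) : eval x (X i) = x i := by
  simp [X, evalFrom_replicate_append_one]

/-- Negation (coefficientwise). [folklore] -/
def neg (p : Poly) : Poly := p.map fun t => (t.1, -t.2)

/-- `eval` of a negation. [folklore] -/
theorem eval_neg (x : ℕ → R) : ∀ p : Poly, eval x (neg p) = -eval x p
  | [] => by simp [neg]
  | (m, c) :: p => by
      have ih := eval_neg x p
      simp only [neg, List.map_cons] at ih ⊢
      rw [eval_cons, eval_cons, ih, Rat.cast_neg]; ring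

/-- A term list all of whose coefficients vanish evaluates to `0`. [folklore] -/
theorem eval_eq_zero_of_all (x : ℕ → R) :
    ∀ p : Poly, (p.all fun t => decide (t.2 = 0)) = true → eval x p = 0
  | [], _ => rfl
  | (m, c) :: p, h => by
      simp only [List.all_cons, Bool.and_eq_true, decide_eq_true_eq] at h
      rw [eval_cons, h.1, eval_eq_zero_of_all x p h.2]; simp

end Field

section CharZero

variable {R : Type*} [Field R] [CharZero R]

/-- Scalar multiple (coefficientwise). [folklore] -/
def smul (a : ℚ) (p : Poly) : Poly := p.map fun t => (t.1, a * t.2)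

/-- `eval` of a scalar multiple. [folklore] -/
theorem eval_smul (x : ℕ → R) (a : ℚ) : ∀ p : Poly, eval x (smul a p) = (a : R) * eval x p
  | [] => by simp [smul]
  | (m, c) :: p => by
      have ih := eval_smul x a p
      simp only [smul, List.map_cons] at ih ⊢
      rw [eval_cons, eval_cons, ih, Rat.cast_mul]; ring

/-- Product with a single term `c · m`. [folklore] -/
def mulTerm (m : Monomial) (c : ℚ) (p : Poly) : Poly := p.map fun t => (Monomial.mul m t.1, c * t.2)

/-- `eval` of a product with a term. [folklore] -/
theorem eval_mulTerm (x : ℕ → R) (m : Monomial) (c : ℚ) :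
    ∀ p : Poly, eval x (mulTerm m c p) = (c : R) * m.eval x * eval x p
  | [] => by simp [mulTerm]
  | (m', c') :: p => by
      have ih := eval_mulTerm x m c p
      simp only [mulTerm, List.map_cons] at ih ⊢
      rw [eval_cons, eval_cons, ih, Rat.cast_mul, Monomial.eval_mul]; ring

/-- Fuelled sorted merge of two term lists, combining equal monomials and dropping the zero
coefficients so created; out of fuel it concatenates (still sound). [folklore] -/
def addF : ℕ → Poly → Poly → Poly
  | 0, p, q => p ++ q
  | _ + 1, [], q => q
  | _ + 1, t :: p, [] => t :: p
  | fuel + 1, (m, c) :: p, (m', c') :: q =>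
    if m = m' then
      (if c + c' = 0 then addF fuel p q else (m, c + c') :: addF fuel p q)
    else if Monomial.blt m m' then (m, c) :: addF fuel p ((m', c') :: q)
    else (m', c') :: addF fuel ((m, c) :: p) q

/-- `eval` of the fuelled merge is the sum of the `eval`s, whatever the fuel and the term order.
[folklore] -/
theorem eval_addF (x : ℕ → R) : ∀ (fuel : ℕ) (p q : Poly), eval x (addF fuel p q) = eval x p + eval x q
  | 0, p, q => by rw [addF, eval_append]
  | _ + 1, [], q => by simp [addF]
  | _ + 1, t :: p, [] => by simp [addF]
  | fuel + 1, (m, c) :: p, (m', c') :: q => by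
      rw [addF]
      split_ifs with hm hc
      · subst hm
        rw [eval_addF x fuel p q, eval_cons, eval_cons]
        have : (c : R) + (c' : R) = 0 := by rw [← Rat.cast_add, hc, Rat.cast_zero]
        linear_combination (-(Monomial.eval x m)) * this
      · subst hm
        rw [eval_cons, eval_addF x fuel p q, eval_cons, eval_cons, Rat.cast_add]; ring
      · rw [eval_cons, eval_addF x fuel p ((m', c') :: q), eval_cons, eval_cons]; ring
      · rw [eval_cons, eval_addF x fuel ((m, c) :: p) q, eval_cons, eval_cons]; ring

/-- Sum of two polynomials (sorted merge with enough fuel). [folklore] -/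
def add (p q : Poly) : Poly := addF (p.length + q.length) p q

/-- `eval` is additive. [folklore] -/
@[simp] theorem eval_add (x : ℕ → R) (p q : Poly) : eval x (add p q) = eval x p + eval x q :=
  eval_addF x _ p q

/-- Product of two polynomials (term by term, accumulated with `add`). [folklore] -/
def mul : Poly → Poly → Poly
  | [], _ => []
  | (m, c) :: p, q => add (mulTerm m c q) (mul p q)

/-- `eval` is multiplicative. [folklore] -/
@[simp] theorem eval_mul (x : ℕ → R) : ∀ p q : Poly, eval x (mul p q) = eval x p * eval x q
  | [], q => by simp [mul]
  | (m, c) :: p, q => by rw [mul, eval_add, eval_mulTerm, eval_mul x p q, eval_cons]; ring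

/-- Normal form of an input polynomial: trim every exponent vector and insert the terms one by
one with `add` (sorted, like terms combined). [folklore] -/
def norm : Poly → Poly
  | [] => []
  | (m, c) :: p => add [(Monomial.trim m, c)] (norm p)

/-- Normalising does not change the value. [folklore] -/
@[simp] theorem eval_norm (x : ℕ → R) : ∀ p : Poly, eval x (norm p) = eval x p
  | [] => rfl
  | (m, c) :: p => by
      rw [norm, eval_add, eval_norm x p, eval_cons, eval_cons, eval_nil, add_zero, Monomial.eval_eq,
        Monomial.eval_eq, Monomial.evalFrom_trim]

/-- Insert a term, combining it with the first term carrying the same exponent vector.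
[folklore] -/
def insertTerm (t : Monomial × ℚ) : Poly → Poly
  | [] => [t]
  | (m, c) :: p => if t.1 = m then (m, t.2 + c) :: p else (m, c) :: insertTerm t p

/-- `eval` after inserting a term. [folklore] -/
theorem eval_insertTerm (x : ℕ → R) (t : Monomial × ℚ) :
    ∀ p : Poly, eval x (insertTerm t p) = (t.2 : R) * t.1.eval x + eval x p
  | [] => by rcases t with ⟨m, c⟩; simp [insertTerm]
  | (m, c) :: p => by
      rcases t with ⟨m₀, c₀⟩
      simp only [insertTerm]
      split_ifs with h
      · have h' : m₀ = m := h
        subst h'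
        rw [eval_cons, eval_cons, Rat.cast_add]; ring
      · rw [eval_cons, eval_cons, eval_insertTerm x (m₀, c₀) p]; ring

/-- Collect like terms by repeated insertion (order-independent normalisation used by the final
zero test). [folklore] -/
def collect : Poly → Poly
  | [] => []
  | t :: p => insertTerm t (collect p)

/-- Collecting like terms does not change the value. [folklore] -/
@[simp] theorem eval_collect (x : ℕ → R) : ∀ p : Poly, eval x (collect p) = eval x p
  | [] => rfl
  | (m, c) :: p => by rw [collect, eval_insertTerm, eval_collect x p, eval_cons]

/-- Zero test: after collecting like terms every coefficient vanishes. [folklore] -/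
def isZero (p : Poly) : Bool := (collect p).all fun t => decide (t.2 = 0)

/-- **Soundness of the zero test**: `isZero p → p.eval x = 0`. [folklore] -/
theorem eval_eq_zero_of_isZero (x : ℕ → R) {p : Poly} (h : isZero p = true) : eval x p = 0 := by
  rw [← eval_collect]; exact eval_eq_zero_of_all x _ h

/-! ### Weighted sums of squares and Positivstellensatz parts -/

/-- Weighted sum of squares `Σ_k w_k · q_k²` of a list of (weight, polynomial) pairs (each `q_k`
is normalised first). [cite: BlekhermanParriloThomas2012, Thm 3.43] -/
def sumSq : List (ℚ × Poly) → Poly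
  | [] => []
  | (w, q) :: rest => add (smul w (mul (norm q) (norm q))) (sumSq rest)

/-- All weights of a (weight, polynomial) list are nonnegative. [folklore] -/
def weightsNonneg (l : List (ℚ × Poly)) : Bool := l.all fun wq => decide (0 ≤ wq.1)

/-- `eval` of a weighted sum of squares. [folklore] -/
theorem eval_sumSq (x : ℕ → R) :
    ∀ l : List (ℚ × Poly), eval x (sumSq l) = (l.map fun wq => (wq.1 : R) * eval x wq.2 ^ 2).sum
  | [] => rfl
  | (w, q) :: rest => by
      rw [sumSq, eval_add, eval_smul, eval_mul, eval_norm, eval_sumSq x rest, List.map_cons,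
        List.sum_cons, sq]

/-- The inequality part `Σ_i g_i · (Σ_k w_{ik} q_{ik}²)` of a Positivstellensatz certificate
(multipliers matched to hypotheses by position; surplus entries on either side are ignored).
[cite: BlekhermanParriloThomas2012, Thm 3.127] -/
def ineqPart : List Poly → List (List (ℚ × Poly)) → Poly
  | g :: gs, s :: ss => add (mul (norm g) (sumSq s)) (ineqPart gs ss)
  | _, _ => []

/-- The equality part `Σ_j h_j · t_j` of a Positivstellensatz certificate (arbitrary polynomial
multipliers, matched by position). [cite: BlekhermanParriloThomas2012, Thm 3.127] -/
def eqPart : List Poly → List Poly → Poly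
  | h :: hs, t :: ts => add (mul (norm h) (norm t)) (eqPart hs ts)
  | _, _ => []

/-- The equality part vanishes wherever the hypotheses `h_j = 0` hold.
[cite: BlekhermanParriloThomas2012, Thm 3.127] -/
theorem eval_eqPart (x : ℕ → R) :
    ∀ (hs ts : List Poly), (∀ h ∈ hs, eval x h = 0) → eval x (eqPart hs ts) = 0
  | h :: hs, t :: ts, hh => by
      rw [eqPart, eval_add, eval_mul, eval_norm, eval_norm, hh h List.mem_cons_self, zero_mul,
        zero_add]
      exact eval_eqPart x hs ts fun h' hh' => hh h' (List.mem_cons_of_mem _ hh')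
  | [], _, _ => by simp [eqPart]
  | _ :: _, [], _ => by simp [eqPart]

/-! ### Certificates, the checker, soundness -/

/-- A **rational SOS / Positivstellensatz certificate** for `p ≥ 0` under hypotheses `gs ≥ 0`,
`hs = 0`: the free weighted-SOS part `sos`, one weighted-SOS multiplier per inequality
hypothesis (`ineqMult`, by position) and one polynomial multiplier per equality hypothesis
(`eqMult`, by position). [cite: BlekhermanParriloThomas2012, Thm 3.127] -/
structure Cert where
  /-- The free part `Σ_k w_k q_k²` as (weight, polynomial) pairs. -/
  sos : List (ℚ × Poly)
  /-- For each hypothesis `g_i ≥ 0`, a weighted SOS multiplier. -/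
  ineqMult : List (List (ℚ × Poly))
  /-- For each hypothesis `h_j = 0`, an arbitrary polynomial multiplier. -/
  eqMult : List Poly

/-- The residual `p − (sos + Σ gᵢ sᵢ + Σ hⱼ tⱼ)` of a certificate. [folklore] -/
def residual (p : Poly) (gs hs : List Poly) (cert : Cert) : Poly :=
  add (norm p) (neg (add (sumSq cert.sos) (add (ineqPart gs cert.ineqMult) (eqPart hs cert.eqMult))))

/-- **The checker**: all weights are nonnegative and the residual is the zero polynomial.
Computable; for numeral data `check p gs hs cert = true` is closed by `decide +kernel`.
[cite: BlekhermanParriloThomas2012, Thm 3.127] -/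
def check (p : Poly) (gs hs : List Poly) (cert : Cert) : Bool :=
  weightsNonneg cert.sos && cert.ineqMult.all weightsNonneg && isZero (residual p gs hs cert)

end CharZero

section Ordered

variable {R : Type*} [Field R] [LinearOrder R] [IsStrictOrderedRing R]

/-- **A weighted sum of squares with nonnegative weights is nonnegative** at every point of a
linearly ordered field. [cite: BlekhermanParriloThomas2012, Thm 3.43] -/
theorem eval_sumSq_nonneg (x : ℕ → R) :
    ∀ l : List (ℚ × Poly), weightsNonneg l = true → 0 ≤ eval x (sumSq l)
  | [], _ => le_rfl
  | (w, q) :: rest, h => by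
      simp only [weightsNonneg, List.all_cons, Bool.and_eq_true, decide_eq_true_eq] at h
      rw [sumSq, eval_add, eval_smul, eval_mul, eval_norm]
      exact add_nonneg (mul_nonneg (by exact_mod_cast h.1) (mul_self_nonneg _))
        (eval_sumSq_nonneg x rest h.2)

/-- The inequality part is nonnegative wherever the hypotheses `g_i ≥ 0` hold.
[cite: BlekhermanParriloThomas2012, Thm 3.127] -/
theorem eval_ineqPart_nonneg (x : ℕ → R) :
    ∀ (gs : List Poly) (ss : List (List (ℚ × Poly))), (∀ g ∈ gs, 0 ≤ eval x g) →
      (∀ s ∈ ss, weightsNonneg s = true) → 0 ≤ eval x (ineqPart gs ss)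
  | g :: gs, s :: ss, hg, hs => by
      rw [ineqPart, eval_add, eval_mul, eval_norm]
      exact add_nonneg
        (mul_nonneg (hg g List.mem_cons_self) (eval_sumSq_nonneg x s (hs s List.mem_cons_self)))
        (eval_ineqPart_nonneg x gs ss (fun g' hg' => hg g' (List.mem_cons_of_mem _ hg'))
          (fun s' hs' => hs s' (List.mem_cons_of_mem _ hs')))
  | [], _, _, _ => by simp [ineqPart]
  | _ :: _, [], _, _ => by simp [ineqPart]

/-- **Soundness of SOS / Positivstellensatz certificates**: if the checker accepts, then
`p(x) ≥ 0` at every point `x` (coordinates in any linearly ordered field, e.g. `ℝ`) where all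
`g ∈ gs` are `≥ 0` and all `h ∈ hs` vanish. [cite: BlekhermanParriloThomas2012, Thm 3.127] -/
theorem nonneg_of_check {p : Poly} {gs hs : List Poly} {cert : Cert}
    (hc : check p gs hs cert = true) (x : ℕ → R) (hg : ∀ g ∈ gs, 0 ≤ eval x g)
    (hh : ∀ h ∈ hs, eval x h = 0) : 0 ≤ eval x p := by
  simp only [check, Bool.and_eq_true, List.all_eq_true] at hc
  obtain ⟨⟨hw, hws⟩, hz⟩ := hc
  have h0 := eval_eq_zero_of_isZero x hz
  rw [residual, eval_add, eval_norm, eval_neg, eval_add, eval_add] at h0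
  have h1 := eval_sumSq_nonneg x cert.sos hw
  have h2 := eval_ineqPart_nonneg x gs cert.ineqMult hg hws
  have h3 := eval_eqPart x hs cert.eqMult hh
  linarith

/-- Unconstrained special case: a weighted SOS certificate gives global nonnegativity.
[cite: BlekhermanParriloThomas2012, Thm 3.43] -/
theorem nonneg_of_check_nil {p : Poly} {cert : Cert} (hc : check p [] [] cert = true)
    (x : ℕ → R) : 0 ≤ eval x p :=
  nonneg_of_check hc x (by simp) (by simp)

end Ordered

end Poly

/-- The point `ℕ → R` whose first coordinates are the entries of the list `l` (then `0`): the
intended way to instantiate `x` in `Poly.nonneg_of_check` (`vars [a, b, c]`). [folklore] -/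
def vars {R : Type*} [Zero R] (l : List R) (i : ℕ) : R := l.getD i 0

/-- `vars` at index `0`. [folklore] -/
@[simp] theorem vars_cons_zero {R : Type*} [Zero R] (a : R) (l : List R) : vars (a :: l) 0 = a := rfl

/-- `vars` at a successor index. [folklore] -/
@[simp] theorem vars_cons_succ {R : Type*} [Zero R] (a : R) (l : List R) (i : ℕ) :
    vars (a :: l) (i + 1) = vars l i := rfl

/-- `vars` of the empty list is `0` (documented junk value past the end). [folklore] -/
@[simp] theorem vars_nil {R : Type*} [Zero R] (i : ℕ) : vars ([] : List R) i = 0 := rfl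

/-! ### Tests / usage templates (kernel-checked) -/

section Tests

open Poly

/-- Test (univariate, unconstrained): `x⁴ − 2x² + 1 = (x² − 1)² ≥ 0`. -/
example (t : ℝ) : 0 ≤ t ^ 4 - 2 * t ^ 2 + 1 := by
  have h := nonneg_of_check_nil (p := [([4], 1), ([2], -2), ([], 1)])
    (cert := ⟨[(1, [([2], 1), ([], -1)])], [], []⟩) (by decide +kernel) (vars [t])
  simp only [eval_cons, eval_nil, Monomial.eval_eq, Monomial.evalFrom_cons, Monomial.evalFrom_nil,
    vars_cons_zero] at h
  push_cast at h
  linarith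

/-- Test (two variables, rational weights): `2a² − 2ab + b²/2 + 1 = 2(a − b/2)² + 1 ≥ 0`, here
with the weaker conclusion `≥ 0` from the certificate `2·(a − b/2)² + 1·1²`. -/
example (a b : ℝ) : 0 ≤ 2 * a ^ 2 - 2 * a * b + b ^ 2 / 2 + 1 := by
  have h := nonneg_of_check_nil (p := [([2], 2), ([1, 1], -2), ([0, 2], 1 / 2), ([], 1)])
    (cert := ⟨[(2, [([1], 1), ([0, 1], -1 / 2)]), (1, [([], 1)])], [], []⟩) (by decide +kernel)
    (vars [a, b])
  simp only [eval_cons, eval_nil, Monomial.eval_eq, Monomial.evalFrom_cons, Monomial.evalFrom_nil,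
    vars_cons_zero, vars_cons_succ] at h
  push_cast at h
  linarith

/-- Test (Positivstellensatz multipliers): from `a ≥ 0` and `b ≥ 0` infer `a³ + b³ − a²b − ab² =
(a + b)(a − b)² ≥ 0`, certificate: inequality multipliers `1·(a − b)²` for both `g₁ = a` and
`g₂ = b`, empty free part. -/
example (a b : ℝ) (ha : 0 ≤ a) (hb : 0 ≤ b) : a ^ 2 * b + a * b ^ 2 ≤ a ^ 3 + b ^ 3 := by
  have h := nonneg_of_check (p := [([3], 1), ([0, 3], 1), ([2, 1], -1), ([1, 2], -1)])
    (gs := [X 0, X 1]) (hs := [])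
    (cert := ⟨[], [[(1, [([1], 1), ([0, 1], -1)])], [(1, [([1], 1), ([0, 1], -1)])]], []⟩)
    (by decide +kernel) (vars [a, b]) (by simpa using And.intro ha hb) (by simp)
  simp only [eval_cons, eval_nil, Monomial.eval_eq, Monomial.evalFrom_cons, Monomial.evalFrom_nil,
    vars_cons_zero, vars_cons_succ] at h
  push_cast at h
  linarith

/-- Test (equality multiplier): on the circle `a² + b² − 1 = 0`, `a + b ≤ 3/2`; certificate
`3/2 − a − b = ½(a − 1)²·… ` — precisely `3/2 − a − b = (1/2)(a−1)² + (1/2)(b−1)² + (1/2)(1 − a² − b²)`,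
i.e. free part with weights `1/2, 1/2` and equality multiplier `t = −1/2`. -/
example (a b : ℚ) (hab : a ^ 2 + b ^ 2 = 1) : a + b ≤ 3 / 2 := by
  have h := nonneg_of_check (p := [([], 3 / 2), ([1], -1), ([0, 1], -1)]) (gs := [])
    (hs := [[([2], 1), ([0, 2], 1), ([], -1)]])
    (cert := ⟨[(1 / 2, [([1], 1), ([], -1)]), (1 / 2, [([0, 1], 1), ([], -1)])], [], [C (-1 / 2)]⟩)
    (by decide +kernel) (vars [a, b]) (by simp) (by
      intro q hq
      simp only [List.mem_singleton] at hq
      subst hq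
      simp only [eval_cons, eval_nil, Monomial.eval_eq, Monomial.evalFrom_cons,
        Monomial.evalFrom_nil, vars_cons_zero, vars_cons_succ]
      push_cast
      linarith)
  simp only [eval_cons, eval_nil, Monomial.eval_eq, Monomial.evalFrom_cons, Monomial.evalFrom_nil,
    vars_cons_zero, vars_cons_succ] at h
  push_cast at h
  linarith

end Tests

/-! ### Preorder (Schmüdgen / Handelman-type) certificates: multipliers on PRODUCTS of hypotheses

`p = Σ_S (∏_{i ∈ S} g_i) · s_S + Σ_j h_j t_j` with weighted-SOS `s_S` (index lists `S`, repetition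
allowed; `S = []` is the free part, `S = [i]` the quadratic-module part of `Cert`). With constant
`s_S` these are the LP-computable Handelman / Krivine certificates of positivity on polytopes;
in general Schmüdgen's preorder certificates (Blekherman–Parrilo–Thomas 2012, Thm 3.127 and
§3.4.4). -/

namespace Poly

section CharZero

variable {R : Type*} [Field R] [CharZero R]

/-- Product `∏_{i ∈ is} g_i` of the hypotheses with the listed indices (an out-of-range index
contributes the factor `1`). [cite: BlekhermanParriloThomas2012, Thm 3.127] -/
def hypProd (gs : List Poly) : List ℕ → Poly
  | [] => C 1
  | i :: is => mul (norm (gs.getD i (C 1))) (hypProd gs is)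

/-- `eval` of a product of hypotheses. [folklore] -/
theorem eval_hypProd (x : ℕ → R) (gs : List Poly) :
    ∀ is : List ℕ, eval x (hypProd gs is) = (is.map fun i => eval x (gs.getD i (C 1))).prod
  | [] => by simp [hypProd]
  | i :: is => by rw [hypProd, eval_mul, eval_norm, eval_hypProd x gs is, List.map_cons, List.prod_cons]

/-- The preorder part `Σ_S (∏_{i∈S} g_i) · (Σ_k w_{S,k} q_{S,k}²)` of a Schmüdgen/Handelman-type
certificate. [cite: BlekhermanParriloThomas2012, Thm 3.127] -/
def preorderPart (gs : List Poly) : List (List ℕ × List (ℚ × Poly)) → Poly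
  | [] => []
  | (is, s) :: rest => add (mul (hypProd gs is) (sumSq s)) (preorderPart gs rest)

/-- A **preorder certificate** for `p ≥ 0` under `gs ≥ 0`, `hs = 0`: weighted-SOS multipliers
`s_S` attached to index lists `S` (products of hypotheses; `[]` = free part) and polynomial
multipliers for the equalities. [cite: BlekhermanParriloThomas2012, Thm 3.127] -/
structure CertP where
  /-- Pairs (index list `S`, weighted SOS `s_S`), contributing `(∏_{i∈S} g_i) · s_S`. -/
  mults : List (List ℕ × List (ℚ × Poly))
  /-- For each hypothesis `h_j = 0`, an arbitrary polynomial multiplier. -/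
  eqMult : List Poly

/-- Residual `p − (Σ_S (∏ g) s_S + Σ hⱼ tⱼ)` of a preorder certificate. [folklore] -/
def residualP (p : Poly) (gs hs : List Poly) (cert : CertP) : Poly :=
  add (norm p) (neg (add (preorderPart gs cert.mults) (eqPart hs cert.eqMult)))

/-- **The preorder checker**: all weights nonnegative and zero residual. Computable; closed by
`decide +kernel` on numeral data. [cite: BlekhermanParriloThomas2012, Thm 3.127] -/
def checkP (p : Poly) (gs hs : List Poly) (cert : CertP) : Bool :=
  (cert.mults.all fun e => weightsNonneg e.2) && isZero (residualP p gs hs cert)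

end CharZero

section Ordered

variable {R : Type*} [Field R] [LinearOrder R] [IsStrictOrderedRing R]

/-- A product of hypotheses is nonnegative wherever all hypotheses are. [folklore] -/
theorem eval_hypProd_nonneg (x : ℕ → R) {gs : List Poly} (hg : ∀ g ∈ gs, 0 ≤ eval x g) :
    ∀ is : List ℕ, 0 ≤ eval x (hypProd gs is)
  | [] => by simp [hypProd]
  | i :: is => by
      rw [hypProd, eval_mul, eval_norm]
      refine mul_nonneg ?_ (eval_hypProd_nonneg x hg is)
      by_cases hi : i < gs.length
      · rw [List.getD_eq_getElem _ _ hi]; exact hg _ (List.getElem_mem hi)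
      · rw [List.getD_eq_default _ _ (not_lt.1 hi)]; simp

/-- The preorder part is nonnegative wherever the hypotheses `g_i ≥ 0` hold and the weights are
nonnegative. [cite: BlekhermanParriloThomas2012, Thm 3.127] -/
theorem eval_preorderPart_nonneg (x : ℕ → R) {gs : List Poly} (hg : ∀ g ∈ gs, 0 ≤ eval x g) :
    ∀ ms : List (List ℕ × List (ℚ × Poly)), (∀ e ∈ ms, weightsNonneg e.2 = true) →
      0 ≤ eval x (preorderPart gs ms)
  | [], _ => by simp [preorderPart]
  | (is, s) :: rest, hw => by
      rw [preorderPart, eval_add, eval_mul]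
      exact add_nonneg (mul_nonneg (eval_hypProd_nonneg x hg is)
          (eval_sumSq_nonneg x s (hw (is, s) List.mem_cons_self)))
        (eval_preorderPart_nonneg x hg rest fun e he => hw e (List.mem_cons_of_mem _ he))

/-- **Soundness of preorder (Schmüdgen / Handelman-type) certificates**: if `checkP` accepts,
then `p(x) ≥ 0` wherever all `g ∈ gs` are `≥ 0` and all `h ∈ hs` vanish (any linearly ordered
field). [cite: BlekhermanParriloThomas2012, Thm 3.127] -/
theorem nonneg_of_checkP {p : Poly} {gs hs : List Poly} {cert : CertP}
    (hc : checkP p gs hs cert = true) (x : ℕ → R) (hg : ∀ g ∈ gs, 0 ≤ eval x g)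
    (hh : ∀ h ∈ hs, eval x h = 0) : 0 ≤ eval x p := by
  simp only [checkP, Bool.and_eq_true, List.all_eq_true] at hc
  obtain ⟨hw, hz⟩ := hc
  have h0 := eval_eq_zero_of_isZero x hz
  rw [residualP, eval_add, eval_norm, eval_neg, eval_add] at h0
  have h1 := eval_preorderPart_nonneg x hg cert.mults hw
  have h2 := eval_eqPart x hs cert.eqMult hh
  linarith

end Ordered

end Poly

section TestsP

open Poly

/-- Test (Handelman-type certificate on the box `0 ≤ a ≤ 1`): `a(1 − a) ≥ 0`, i.e.
`0 ≤ a − a²`, certificate `(g₀ g₁) · 1` with `g₀ = a`, `g₁ = 1 − a`. -/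
example (a : ℝ) (h0 : 0 ≤ a) (h1 : a ≤ 1) : a ^ 2 ≤ a := by
  have h := nonneg_of_checkP (p := [(([1] : List ℕ), (1 : ℚ)), (([2] : List ℕ), (-1 : ℚ))])
    (gs := [X 0, [(([] : List ℕ), (1 : ℚ)), (([1] : List ℕ), (-1 : ℚ))]]) (hs := [])
    (cert := ⟨[(([0, 1] : List ℕ), [((1 : ℚ), C 1)])], []⟩)
    (by decide +kernel) (vars [a]) (by
      intro g hg
      simp only [List.mem_cons, List.not_mem_nil, or_false] at hg
      rcases hg with rfl | rfl
      · simpa using h0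
      · simp only [eval_cons, eval_nil, Monomial.eval_eq, Monomial.evalFrom_cons,
          Monomial.evalFrom_nil, vars_cons_zero]
        push_cast
        linarith) (by simp)
  simp only [eval_cons, eval_nil, Monomial.eval_eq, Monomial.evalFrom_cons, Monomial.evalFrom_nil,
    vars_cons_zero] at h
  push_cast at h
  nlinarith [h]

end TestsP

end SOS

end Literature.Computation.Certificates
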